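import Literature.AlgebraicGeometry.HodgeTheory.LefschetzPencilHyperplaneSections
import Literature.AlgebraicGeometry.HodgeTheory.LinearSectionPencilFibres
import Literature.AlgebraicGeometry.Motives.LinearSectionNetBertini
import HarnessLib

/-!
# Pencils of hyperplane sections as nets over `ℙ¹` — `exists_fiberNet_pencil_weakLefschetz_holds`

Topic `Literature/AlgebraicGeometry/HodgeTheory`. Sibling proof file of
`HodgeTheory/LefschetzPencilHyperplaneSections`: it DISCHARGES the named fact
`exists_fiberNet_pencil_weakLefschetz` of that file (theorems only; no definitions, no named
facts).

For a smooth projective `X` over an algebraically closed field `k`, a closed immersion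
`ι : X ⟶ ℙᴺ` and linear forms `a₀, …, a_m` forming a Bertini-general centre
(`LinearSectionNet.GoodCentre`, `LinearSectionNet.exists_goodCentre` — Hartshorne II Thm. 8.18), the
tree's net of linear sections `X ←σ— X̃ —π→ ℙᵐ` (`Motives/LinearSectionNet`,
`Motives/LinearSectionNetBertini`: `X̃ = {(x, b) ∈ X × ℙᵐ | aᵢ(x) b_{i'} = a_{i'}(x) bᵢ}`, smooth
projective, `σ` an isomorphism off the base locus, `π` with geometrically connected fibres) is a
`Motives.FiberNet r m X` with these concrete fields (the structure literal is written inside the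
proofs below; the tree's `LinearSectionNet.nonempty_fiberNet` asserts `Nonempty`). For `m = 1`
(pencils of hyperplane sections, Voisin II §2.1.1) and `t` in the smooth base, the fibre `π⁻¹(t)` is
a smooth projective `r`-fold (`FiberNet.isSmoothProjective_fiber_of_mem_smoothBase`; the smooth
base is non-empty in characteristic `0`, `FiberNet.smoothBase_nonempty_of_charZero`), and weak
Lefschetz for `π⁻¹(t) ⟶ X̃ ⟶ X` is the range-based theorem of
`HodgeTheory/LinearSectionPencilFibres` (the complex points of `π⁻¹(t)` in `X` are those of the
hyperplane section `X ∩ H_t`).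

* `geometricallyConnected_proj_of_goodCentre`, `baseLocus_zero` — inputs;
* `exists_fiberNet_pencil_weakLefschetz_holds` — the named fact;
* `exists_goodPencil` — over `ℂ`: a pencil `a ≠ 0` with smooth projective total space of dimension
  `m + 1` whose members off a proper closed subset of `ℙ¹` are smooth projective `m`-folds (the
  input format of the pencil descent, `HodgeTheory/PencilStepBelowMiddleOfSpread`).

## References

* [VoisinHodgeII2003] C. Voisin, Hodge Theory and Complex Algebraic Geometry II (2003), §2.1.1,
  §2.3.1, §1.2.2 Thm. 1.23.
* [Hartshorne1977] R. Hartshorne, Algebraic Geometry (1977), II Example 7.17.3, II Thm. 8.18,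
  III Cor. 10.7.
-/

noncomputable section

open CategoryTheory CategoryTheory.Limits AlgebraicGeometry
open Literature.AlgebraicGeometry.Motives
open Literature.AlgebraicGeometry.Motives.LinearSectionNet

universe u

namespace Literature.AlgebraicGeometry.HodgeTheory

section HodgeTheory

/-! ### Inputs: connected fibres of `π`, the base locus of the zero pencil -/

section Net

variable {k : Type u} [Field k] {N m n : ℕ} {X : SchemeOver k} (ι : X ⟶ projectiveSpace N k)

/-- If all the forms vanish, the base locus `X ∩ V(0, …, 0)` is all of `X`. [folklore] -/
theorem baseLocus_zero : baseLocus ι (0 : Fin (m + 1) → Fin (N + 1) → k) = Set.univ := by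
  letI : GradedAlgebra (Segre.grading (Fin (N + 1)) k) := MvPolynomial.gradedAlgebra
  ext x
  simp only [Set.mem_univ, iff_true]
  rw [baseLocus, Resolution.LinSec.cutSet, Set.mem_iInter]
  intro i
  rw [Resolution.LinSec.mem_hyp_iff]
  change x ∉ ι.left ⁻¹ᵁ Proj.basicOpen _ (Resolution.LinSec.linForm (0 : Fin (N + 1) → k))
  have h0 : Resolution.LinSec.linForm (0 : Fin (N + 1) → k) = 0 := by
    simp [Resolution.LinSec.linForm]
  rw [h0, Proj.basicOpen_zero]
  intro hx
  exact hx

/-- The complement of a base locus which is not everything is non-empty. [folklore] -/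
theorem coe_offBase_nonempty {a : Fin (m + 1) → Fin (N + 1) → k} (hnu : baseLocus ι a ≠ Set.univ) :
    ((offBase ι a : X.left.Opens) : Set X.left).Nonempty := by
  obtain ⟨x, hx⟩ := (Set.ne_univ_iff_exists_notMem _).mp hnu
  exact ⟨x, hx⟩

variable [IsAlgClosed k] [IsClosedImmersion ι.left]

/-- **`π : X̃ → ℙᵐ` has geometrically connected fibres** for a good centre with non-empty base locus
not all of `X`: through a closed point of the base locus passes a rational point `β` (the field is
algebraically closed), whose section `s_β` makes `π` geometrically connected
(`LinearSectionNet.geometricallyConnected_proj_left`). [cite: Hartshorne1977, II Example 7.17.3] -/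
theorem geometricallyConnected_proj_of_goodCentre (hX : IsSmoothProjective n X)
    {a : Fin (m + 1) → Fin (N + 1) → k} (hF : GoodCentre ι a) (hne : (baseLocus ι a).Nonempty)
    (hnu : baseLocus ι a ≠ Set.univ) : GeometricallyConnected (proj ι a).left := by
  haveI := hX.smoothOfRelativeDimension
  haveI : Smooth X.hom := SmoothOfRelativeDimension.smooth n _
  have hJ : JacobsonSpace X.left := LocallyOfFiniteType.jacobsonSpace X.hom
  obtain ⟨x₀, hx₀F, hx₀⟩ := nonempty_inter_closedPoints hne (isClosed_baseLocus ι a).isLocallyClosed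
  obtain ⟨τ, hτ⟩ := exists_point_through_closedPoint X.hom k (mem_closedPoints_iff.mp hx₀)
  let β : AlgPoints X k := AlgPoints.mk (Spec.map τ ≫ X.left.fromSpecResidueField x₀) hτ
  have hβ : β.pt = x₀ := by
    change (X.left.fromSpecResidueField x₀) ((Spec.map τ) (IsLocalRing.closedPoint k)) = x₀
    exact Scheme.fromSpecResidueField_apply _ _
  exact geometricallyConnected_proj_left ι hX hF (coe_offBase_nonempty ι hnu) β (hβ ▸ hx₀F)

end Net

/-! ### The named fact -/

/-- **Pencils of hyperplane sections exist and their smooth members satisfy the Lefschetz hyperplane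
theorem through the blow-down — discharge of the named fact `exists_fiberNet_pencil_weakLefschetz`.**
For `r ≥ 1` and `X` smooth projective of dimension `1 + r` over `ℂ`: embed `X ↪ ℙᴺ`, choose a
Bertini-general centre of two linear forms (`LinearSectionNet.exists_goodCentre`, Hartshorne II
Thm. 8.18) and take the net of linear sections over `ℙ¹` (the `FiberNet r 1 X` with total space
`total ι a`, blow-down `blowDown ι a = pr₁`, an isomorphism off the base locus
(`isIso_blowDown_restrict_offBase`), net map `proj ι a = pr₂` with geometrically connected fibres,
smooth of relative dimension `r` where smooth — Hartshorne II Example 7.17.3, Voisin II §2.1.1); over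
a complex point `t` of its smooth base the fibre is a smooth projective `r`-fold, and
`π⁻¹(t) ⟶ X̃ ⟶ X`, a closed immersion whose image on complex points is the hyperplane section
`X ∩ H_t`, induces `Hᵏ(X(ℂ); ℂ) → Hᵏ(π⁻¹(t)(ℂ); ℂ)` bijective for `k < r` and injective for
`k = r` (`bijective_complexBettiMap_fiberι_blowDown_of_lt`, `injective_complexBettiMap_fiberι_blowDown`:
Andreotti–Frankel and duality, Voisin II Thm. 1.23).
[cite: VoisinHodgeII2003, §2.1.1, §2.3.1 and §1.2.2 Thm. 1.23]
[cite: Hartshorne1977, II Thm. 8.18 and II Example 7.17.3] -/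
theorem exists_fiberNet_pencil_weakLefschetz_holds : exists_fiberNet_pencil_weakLefschetz := by
  intro r X hr hX
  have hX' : IsSmoothProjective (r + 1) X := Nat.add_comm 1 r ▸ hX
  obtain ⟨N, ι, hι⟩ := hX.isProjectiveOver
  obtain ⟨a, hF, hne, hnu⟩ := LinearSectionNet.exists_goodCentre (m := 1) ι hX (by omega)
  haveI : IsIntegral X.left := IsSmoothProjective.isIntegral_holds hX
  have hT : IsSmoothProjective (1 + r) (total ι a) :=
    isSmoothProjective_total ι hX hF (coe_offBase_nonempty ι hnu)
  haveI := geometricallyConnected_proj_of_goodCentre ι hX hF hne hnu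
  let Nt : FiberNet r 1 X :=
    { total := total ι a
      isSmoothProjective_total := hT
      blowDown := blowDown ι a
      baseLocus := baseLocus ι a
      isClosed_baseLocus := isClosed_baseLocus ι a
      baseLocus_ne_univ := hnu
      isIso_blowDown_restrict := isIso_blowDown_restrict_offBase ι a
      proj := proj ι a
      geometricallyConnected_proj := inferInstance
      smoothOfRelativeDimension_restrict := fun U hU ↦
        smoothOfRelativeDimension_morphismRestrict_of_isSmoothProjective hT (proj ι a) U hU }
  refine ⟨Nt, fun t ht ↦ ?_⟩
  have hY : IsSmoothProjective r (fiberOver (proj ι a) t) := Nt.isSmoothProjective_fiber_of_mem_smoothBase t ht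
  exact ⟨fun k hk ↦ bijective_complexBettiMap_fiberι_blowDown_of_lt ι a hX' t hY hk,
    injective_complexBettiMap_fiberι_blowDown ι a hX' t hY le_rfl⟩

/-- **Good pencils over `ℂ`.** On a smooth projective `X` of dimension `m + 1 ≥ 2` with a closed
immersion `ι : X ⟶ ℙᴺ` there are two linear forms `a = (a₀, a₁) ≠ 0` whose pencil has smooth
projective total space `X̃ = total ι a` of dimension `m + 1` and whose members `π⁻¹(s)` over the
complex points `s` off a proper Zariski-closed `T ⊆ ℙ¹` (the discriminant) are smooth projective
`m`-folds — Bertini for the centre (`exists_goodCentre`), the net of linear sections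
(`isSmoothProjective_total`, geometrically connected fibres), generic smoothness
(`FiberNet.smoothBase_nonempty_of_charZero`) and `FiberNet.exists_isClosed_forall_isSmoothProjective_fiber`.
[cite: Hartshorne1977, II Thm. 8.18, II Example 7.17.3 and III Cor. 10.7] [cite: VoisinHodgeII2003, §2.1.1] -/
theorem exists_goodPencil {m N : ℕ} {X : SchemeOver ℂ} (hX : IsSmoothProjective (m + 1) X)
    (ι : X ⟶ projectiveSpace N ℂ) [IsClosedImmersion ι.left] (hm : 1 ≤ m) :
    ∃ a : Fin (1 + 1) → Fin (N + 1) → ℂ, a ≠ 0 ∧ IsSmoothProjective (m + 1) (total ι a) ∧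
      ∃ T : Set (projectiveSpace 1 ℂ).left, IsClosed T ∧ T ≠ Set.univ ∧
        ∀ s : ComplexPoints (projectiveSpace 1 ℂ), s.pt ∉ T → IsSmoothProjective m (fiberOver (proj ι a) s) := by
  obtain ⟨a, hF, hne, hnu⟩ := LinearSectionNet.exists_goodCentre (m := 1) ι hX (by omega)
  have ha : a ≠ 0 := by
    rintro rfl
    exact hnu (baseLocus_zero ι)
  haveI : IsIntegral X.left := IsSmoothProjective.isIntegral_holds hX
  have hT : IsSmoothProjective (m + 1) (total ι a) :=
    isSmoothProjective_total ι hX hF (coe_offBase_nonempty ι hnu)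
  have hT' : IsSmoothProjective (1 + m) (total ι a) := Nat.add_comm m 1 ▸ hT
  haveI := geometricallyConnected_proj_of_goodCentre ι hX hF hne hnu
  let Nt : FiberNet m 1 X :=
    { total := total ι a
      isSmoothProjective_total := hT'
      blowDown := blowDown ι a
      baseLocus := baseLocus ι a
      isClosed_baseLocus := isClosed_baseLocus ι a
      baseLocus_ne_univ := hnu
      isIso_blowDown_restrict := isIso_blowDown_restrict_offBase ι a
      proj := proj ι a
      geometricallyConnected_proj := inferInstance
      smoothOfRelativeDimension_restrict := fun U hU ↦
        smoothOfRelativeDimension_morphismRestrict_of_isSmoothProjective hT' (proj ι a) U hU }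
  obtain ⟨T, hTc, hTne, hfib⟩ := Nt.exists_isClosed_forall_isSmoothProjective_fiber
    Nt.smoothBase_nonempty_of_charZero
  exact ⟨a, ha, hT, T, hTc, hTne, hfib⟩

end HodgeTheory

end Literature.AlgebraicGeometry.HodgeTheory

end
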